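/-
Copyright (c) 2026 the pub-hodgecm-mathlib formalisation cell (harness21).  Prover seat hodgecm-mathlib-K2Liu-p05 (g5), Track B «K2-LIT»,
#184♮ = hLiu418 = `stmt-HodgeConjecture-24832`; #42S payer road, organ S2 (archimedean spanning), S2-asm FILE 3-b step 1 (Hermite glue with degrees;
LEAD F0P6-plan (g14) BATCH #22 (1) «S2-asm FILE 3 = p05»; sequel of ★ J2d `K2LiuArchWeilJunctionHermite`).
-/
import Summits.HodgeConjecture.HodgeConjecture.Theorems.K2LiuArchWeilJunctionHermite       -- ★ J2d (`frame_follandHermite_eq_tensorPi_hermitePi`, J2c)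
import Literature.NumberTheory.GelbartRogawski1991.DoubledWeilRepresentationArchVacuum      -- ★ `GRConstruction.frameD`, `follandHermite`
import Literature.RepresentationTheory.KonnoKonno2007.JunctionHyperbolicReindex            -- ★ `schwartzTransport_reindexCLE(_symm)_hermitePi`
import Literature.Analysis.SegalBargmann.SchwartzTensorPi                                   -- ★ `hermitePi_sumIdx`
import HarnessLib

/-!
# Crux `HLiu418`, #42S organ S2, S2-asm FILE 3-b step 1: THE HERMITE GLUE WITH DEGREES — every Hermite vector of the big frame splits at `σ` into
# `(e_* h_{β₁}) ⊠ h_{β₂}` with `|β| = |β₁| + |β₂|`, and every pair `(β₁, β₂)` glues back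

Cell `hodgecm-mathlib`, crux item hLiu418 = `stmt-HodgeConjecture-24832`; squad K2 ∕ K2Liu; LEAD F0P6-plan (g14) BATCH #22 (1) (S2-asm FILE 3 = K2Liu-p05); prover K2Liu-p05 (g5).
THEOREMS ONLY (no `def`, no instance, no notation, no named-fact hypothesis, no `sorry`); lane `--supports stmt-HodgeConjecture-24832 --as helper`.

WHY (σ15 datum transport, S2-J by name per ★ `K2LiuArchWeilFockFiniteDatum`).  The realiser datum of `ArchSWRegionSpanning` is the span `V_D` of the Hermite vectors
`follandHermite frameD β`, `|β| ≤ D`, of the big scaled Folland frame; its stability under the one-place compact generators is read at each real place `σ` in the junction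
frame `𝒥_σ`, where the place-`σ` factor moves inside the degree filtration `B⁻¹(𝒫_{≤d}) = span {h_γ : |γ| ≤ d}` (★ `weilDatum_κ_mem_fockLe`).  The bookkeeping this needs —
and all this file proves — is the two-way Hermite glue WITH TOTAL DEGREES:
* §1 (generic `Finsupp` degrees) `degree_mapDomain_of_injective`, `degree_equivMapDomain`, `degree_sumIdx`, `degree_eq_degree_comapDomain_add`;
* §2 **`exists_degree_frame_follandHermite_eq_tensorPi`** — `∀ β₁ β₂, ∃ β, |β| = |β₁| + |β₂| ∧ 𝒥 (follandHermite frameD β) = (e_* h_{β₁}) ⊠ h_{β₂}` (★ J2d's witness, degree counted);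
  **`exists_degree_split_frame_follandHermite`** — `∀ β, ∃ β₁ β₂, |β| = |β₁| + |β₂| ∧ 𝒥 (follandHermite frameD β) = (e_* h_{β₁}) ⊠ h_{β₂}` (★ `hermitePi_eq_tensorPi`, ★
  `sumIdx_comapDomain`, ★ `schwartzTransport_reindexCLE(_symm)_hermitePi`).
References: [Folland1989] §1.7 (1.81); [Howe1989] §3; [KonnoKonno2007] §3.3.
HONEST LABEL.  Count-neutral helper: `HC_CM` is proved only modulo the 7 printed citations (2 remaining named inputs: hLiu418 = `stmt-HodgeConjecture-24832`,
h413 = `stmt-HodgeConjecture-24833`) until rung 0 closes.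
-/

set_option autoImplicit false
set_option linter.dupNamespace false -- the mandated namespace repeats `HodgeConjecture.HodgeConjecture`
set_option synthInstance.maxSize 512 -- `DecidableEq` of the nested block index (as ★ `K2LiuWeilSeesawRelabel`)

noncomputable section

open scoped Classical Matrix TensorProduct Kronecker SchwartzMap
open NumberField NumberField.InfinitePlace NumberField.mixedEmbedding IsDedekindDomain
open Literature.Analysis.SegalBargmann Literature.RepresentationTheory.HeisenbergGroup
open Literature.NumberTheory.Automorphic Literature.NumberTheory.Automorphic.UnitaryGroup Literature.NumberTheory.GaloisRepresentations
open Literature.NumberTheory.Weil1964 Literature.NumberTheory.Weil1964.MpS Literature.NumberTheory.Weil1964.UnitaryWeil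
open Literature.RepresentationTheory.HarrisKudlaSweet1996
open Literature.RepresentationTheory.KonnoKonno2007 Literature.RepresentationTheory.KonnoKonno2007.RealDualPair
open Literature.NumberTheory.GelbartRogawski1991 Literature.NumberTheory.GelbartRogawski1991.GRConstruction
open Literature.NumberTheory.GelbartRogawski1991.UnitaryDualPair
open Literature.NumberTheory.GelbartRogawski1991.UnitaryDualPair.LocalSplitting
open Literature.NumberTheory.K2Lit.SiegelDoubled
open Summit.HodgeConjecture.HodgeConjecture.Cruxes.HLiu418.K2LiuArchSectionPlaceBlock
open Summit.HodgeConjecture.HodgeConjecture.Cruxes.HLiu418 (K2LiuArchOneParameterOrbitDefs.archEmb)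
open Summit.HodgeConjecture.HodgeConjecture.Cruxes.HLiu418.K2LiuSwSectionArchOrbit
open Summit.HodgeConjecture.HodgeConjecture.Cruxes.HLiu418.K2LiuWeilSeesawRelabel
open Summit.HodgeConjecture.HodgeConjecture.Cruxes.HLiu418.K2LiuArchWeilJunctionTransport
open Summit.HodgeConjecture.HodgeConjecture.Cruxes.HLiu418.K2LiuArchWeilJunctionHermite

namespace Summit.HodgeConjecture.HodgeConjecture.Cruxes.HLiu418.K2LiuArchHermiteGlue

/-! ## §1 Total degrees of multi-indices under relabelling and juxtaposition -/
section Degree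

variable {σ₁ σ₂ : Type}

/-- `|β ∘ f⁻¹| = |β|` for an injective relabelling. [cite: Folland1989, §1.7 (1.81)] -/
theorem degree_mapDomain_of_injective (f : σ₁ → σ₂) (hf : Function.Injective f) (β : σ₁ →₀ ℕ) : (β.mapDomain f).degree = β.degree := by
  have h1 : ∀ c : σ₂ →₀ ℕ, c.degree = c.sum (fun _ m => m) := fun c => by rw [Finsupp.degree_apply]; rfl
  have h2 : ∀ c : σ₁ →₀ ℕ, c.degree = c.sum (fun _ m => m) := fun c => by rw [Finsupp.degree_apply]; rfl
  rw [h1, h2, Finsupp.sum_mapDomain_index_inj hf]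

/-- `|β.equivMapDomain e| = |β|`. [cite: Folland1989, §1.7 (1.81)] -/
theorem degree_equivMapDomain (e : σ₁ ≃ σ₂) (β : σ₁ →₀ ℕ) : (β.equivMapDomain e).degree = β.degree := by
  rw [Finsupp.equivMapDomain_eq_mapDomain, degree_mapDomain_of_injective _ e.injective]

/-- `|(β₁, β₂)| = |β₁| + |β₂|` (★ `sumIdx`). [cite: Folland1989, §1.7] -/
theorem degree_sumIdx (β₁ : σ₁ →₀ ℕ) (β₂ : σ₂ →₀ ℕ) : (sumIdx β₁ β₂).degree = β₁.degree + β₂.degree := by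
  rw [sumIdx, map_add, degree_mapDomain_of_injective _ Sum.inl_injective, degree_mapDomain_of_injective _ Sum.inr_injective]

/-- `|β| = |β|ᵢₙₗ + |β|ᵢₙᵣ` for a multi-index on `σ₁ ⊕ σ₂` (★ `sumIdx_comapDomain`). [cite: Folland1989, §1.7] -/
theorem degree_eq_degree_comapDomain_add (β : σ₁ ⊕ σ₂ →₀ ℕ) :
    β.degree = (β.comapDomain Sum.inl Sum.inl_injective.injOn).degree + (β.comapDomain Sum.inr Sum.inr_injective.injOn).degree := by
  rw [← degree_sumIdx, sumIdx_comapDomain]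

end Degree

/-! ## §2 The two-way glue at the big frame, with degrees -/
section Frame

variable (L : Type) [Field L] [NumberField L] [IsCMField L]
variable {N M n : ℕ} (e : Fin N × Fin M ≃ Fin n)
  (dV : Fin N → L) (hdV : ∀ i, IsCMField.complexConj L (dV i) = dV i) (hdV0 : ∀ i, dV i ≠ 0)
  (dW : Fin M → L) (hdW : ∀ i, IsCMField.complexConj L (dW i) = dW i) (hdW0 : ∀ i, dW i ≠ 0)
variable {M₂ M' n' : ℕ} (eW : Fin M × Fin M₂ ≃ Fin M') (e' : Fin N × Fin M' ≃ Fin n')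
  (dV' : Fin M₂ → L) (hdV' : ∀ k, IsCMField.complexConj L (dV' k) = dV' k) (hdV'0 : ∀ k, dV' k ≠ 0)
variable (σ : {v : InfinitePlace (Fp L) // v.IsReal})
  {P Q R S : Type} [Fintype P] [DecidableEq P] [Fintype Q] [DecidableEq Q] [Fintype R] [DecidableEq R] [Fintype S] [DecidableEq S]
  (eP : PosIdx (signVec (cmPlaceOver L) (fun k => Sum.elim (cmGramEntry L e' dV hdV (tensorFrame L dW eW dV') (tensorFrame_real L dW hdW eW dV' hdV')) (-cmGramEntry L e' dV hdV (tensorFrame L dW eW dV') (tensorFrame_real L dW hdW eW dV' hdV')) ((LocalSplitting.e₂ n').symm k)) (imagUnit L) σ) ≃ (P × R) ⊕ (Q × S))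
  (eQ : NegIdx (signVec (cmPlaceOver L) (fun k => Sum.elim (cmGramEntry L e' dV hdV (tensorFrame L dW eW dV') (tensorFrame_real L dW hdW eW dV' hdV')) (-cmGramEntry L e' dV hdV (tensorFrame L dW eW dV') (tensorFrame_real L dW hdW eW dV' hdV')) ((LocalSplitting.e₂ n').symm k)) (imagUnit L) σ) ≃ (P × S) ⊕ (Q × R))


-- the CM sign frame of the big datum elaborates slowly (as ★ J2c∕J2d)
set_option maxHeartbeats 4000000

/-- **GLUE**: for all `β₁` (place-`σ` junction block of the pair) and `β₂` (other places) there is `β` with `|β| = |β₁| + |β₂|` and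
`𝒥 (follandHermite frameD β) = (e_* h_{β₁}) ⊠ h_{β₂}` (★ J2d's witness, its degree counted by §1). [cite: Folland1989, §1.7 (1.81)] -/
theorem exists_degree_frame_follandHermite_eq_tensorPi (β₁ : DPIdx P Q R S →₀ ℕ) (β₂ : (Fin (n' + n') × {v : {v : InfinitePlace (Fp L) // v.IsReal} // v ≠ σ}) →₀ ℕ) :
    ∃ β : (Fin (n' + n') × {v : InfinitePlace (Fp L) // v.IsReal}) →₀ ℕ, β.degree = β₁.degree + β₂.degree ∧
      ((((schwartzTransport
                  (scaledFrame (Fp L) (Fin (n' + n'))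
                    (placeScale (n' + n') fun v => sqrtAbs (signVec (cmPlaceOver L)
                      (fun k => Sum.elim (cmGramEntry L e' dV hdV (tensorFrame L dW eW dV') (tensorFrame_real L dW hdW eW dV' hdV')) (-cmGramEntry L e' dV hdV (tensorFrame L dW eW dV') (tensorFrame_real L dW hdW eW dV' hdV')) ((LocalSplitting.e₂ n').symm k))
                      (imagUnit L) v))
                    (placeScale_ne_zero (n' + n') (sqrtAbs_signVec_ne_zero (IsCMField.complexConj_ne_one L) (cmPlaceOver_smul L)
                      (complexConj_imagUnit L) (imagUnit_ne_zero L) (gramD_gram_realDiagonal_entry_ne_zero L e' dV hdV (tensorFrame L dW eW dV') (tensorFrame_real L dW hdW eW dV' hdV') hdV0 (tensorFrame_ne_zero L dW eW dV' hdW0 hdV'0)))))).trans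
                (schwartzTransport (reindexCLE (placeSplitEquiv (signSplit (signVec (cmPlaceOver L)
                  (fun k => Sum.elim (cmGramEntry L e' dV hdV (tensorFrame L dW eW dV') (tensorFrame_real L dW hdW eW dV' hdV')) (-cmGramEntry L e' dV hdV (tensorFrame L dW eW dV') (tensorFrame_real L dW hdW eW dV' hdV')) ((LocalSplitting.e₂ n').symm k))
                  (imagUnit L) σ)) σ)))).trans
                (schwartzTransport (reindexCLE (Equiv.sumCongr
                  (unitJunctionIdx
                    (PosIdx (signVec (cmPlaceOver L)
                      (fun k => Sum.elim (cmGramEntry L e' dV hdV (tensorFrame L dW eW dV') (tensorFrame_real L dW hdW eW dV' hdV')) (-cmGramEntry L e' dV hdV (tensorFrame L dW eW dV') (tensorFrame_real L dW hdW eW dV' hdV')) ((LocalSplitting.e₂ n').symm k))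
                      (imagUnit L) σ))
                    (NegIdx (signVec (cmPlaceOver L)
                      (fun k => Sum.elim (cmGramEntry L e' dV hdV (tensorFrame L dW eW dV') (tensorFrame_real L dW hdW eW dV' hdV')) (-cmGramEntry L e' dV hdV (tensorFrame L dW eW dV') (tensorFrame_real L dW hdW eW dV' hdV')) ((LocalSplitting.e₂ n').symm k))
                      (imagUnit L) σ))).symm
                  (Equiv.refl (Fin (n' + n') × {v : {v : InfinitePlace (Fp L) // v.IsReal} // v ≠ σ})))))).trans
                (schwartzTransport (reindexCLE (Equiv.sumCongr
                  (dpIdxCongr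
                    (PosIdx (signVec (cmPlaceOver L)
                      (fun k => Sum.elim (cmGramEntry L e' dV hdV (tensorFrame L dW eW dV') (tensorFrame_real L dW hdW eW dV' hdV')) (-cmGramEntry L e' dV hdV (tensorFrame L dW eW dV') (tensorFrame_real L dW hdW eW dV' hdV')) ((LocalSplitting.e₂ n').symm k))
                      (imagUnit L) σ))
                    (NegIdx (signVec (cmPlaceOver L)
                      (fun k => Sum.elim (cmGramEntry L e' dV hdV (tensorFrame L dW eW dV') (tensorFrame_real L dW hdW eW dV' hdV')) (-cmGramEntry L e' dV hdV (tensorFrame L dW eW dV') (tensorFrame_real L dW hdW eW dV' hdV')) ((LocalSplitting.e₂ n').symm k))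
                      (imagUnit L) σ))
                    Unit Empty ((P × R) ⊕ (Q × S)) ((P × S) ⊕ (Q × R)) Unit Empty eP eQ (Equiv.refl Unit) (Equiv.refl Empty)).symm
                  (Equiv.refl (Fin (n' + n') × {v : {v : InfinitePlace (Fp L) // v.IsReal} // v ≠ σ})))))) (follandHermite (GRConstruction.frameD L e' dV hdV hdV0 (tensorFrame L dW eW dV') (tensorFrame_real L dW hdW eW dV' hdV') (tensorFrame_ne_zero L dW eW dV' hdW0 hdV'0)) β) =
        tensorPi ((schwartzTransport (reindexCLE (unitJunctionIdx ((P × R) ⊕ (Q × S)) ((P × S) ⊕ (Q × R))).symm)) (hermitePi β₁)) (hermitePi β₂) := by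
  refine ⟨(((sumIdx (β₁.equivMapDomain (unitJunctionIdx ((P × R) ⊕ (Q × S)) ((P × S) ⊕ (Q × R)))) β₂).equivMapDomain
      (Equiv.sumCongr
        (dpIdxCongr (PosIdx (signVec (cmPlaceOver L) (fun k => Sum.elim (cmGramEntry L e' dV hdV (tensorFrame L dW eW dV') (tensorFrame_real L dW hdW eW dV' hdV')) (-cmGramEntry L e' dV hdV (tensorFrame L dW eW dV') (tensorFrame_real L dW hdW eW dV' hdV')) ((LocalSplitting.e₂ n').symm k)) (imagUnit L) σ)) (NegIdx (signVec (cmPlaceOver L) (fun k => Sum.elim (cmGramEntry L e' dV hdV (tensorFrame L dW eW dV') (tensorFrame_real L dW hdW eW dV' hdV')) (-cmGramEntry L e' dV hdV (tensorFrame L dW eW dV') (tensorFrame_real L dW hdW eW dV' hdV')) ((LocalSplitting.e₂ n').symm k)) (imagUnit L) σ)) Unit Empty ((P × R) ⊕ (Q × S)) ((P × S) ⊕ (Q × R)) Unit Empty eP eQ (Equiv.refl Unit)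
          (Equiv.refl Empty)).symm
        (Equiv.refl (Fin (n' + n') × {v : {v : InfinitePlace (Fp L) // v.IsReal} // v ≠ σ})))).equivMapDomain
      (Equiv.sumCongr (unitJunctionIdx (PosIdx (signVec (cmPlaceOver L) (fun k => Sum.elim (cmGramEntry L e' dV hdV (tensorFrame L dW eW dV') (tensorFrame_real L dW hdW eW dV' hdV')) (-cmGramEntry L e' dV hdV (tensorFrame L dW eW dV') (tensorFrame_real L dW hdW eW dV' hdV')) ((LocalSplitting.e₂ n').symm k)) (imagUnit L) σ)) (NegIdx (signVec (cmPlaceOver L) (fun k => Sum.elim (cmGramEntry L e' dV hdV (tensorFrame L dW eW dV') (tensorFrame_real L dW hdW eW dV' hdV')) (-cmGramEntry L e' dV hdV (tensorFrame L dW eW dV') (tensorFrame_real L dW hdW eW dV' hdV')) ((LocalSplitting.e₂ n').symm k)) (imagUnit L) σ))).symm (Equiv.refl (Fin (n' + n') × {v : {v : InfinitePlace (Fp L) // v.IsReal} // v ≠ σ})))).equivMapDomain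
      (placeSplitEquiv (signSplit (signVec (cmPlaceOver L) (fun k => Sum.elim (cmGramEntry L e' dV hdV (tensorFrame L dW eW dV') (tensorFrame_real L dW hdW eW dV' hdV')) (-cmGramEntry L e' dV hdV (tensorFrame L dW eW dV') (tensorFrame_real L dW hdW eW dV' hdV')) ((LocalSplitting.e₂ n').symm k)) (imagUnit L) σ)) σ), ?_, ?_⟩
  · rw [degree_equivMapDomain, degree_equivMapDomain, degree_equivMapDomain, degree_sumIdx, degree_equivMapDomain]
  · rw [schwartzTransport_reindexCLE_hermitePi, ← hermitePi_sumIdx]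
    simp only [ContinuousLinearEquiv.trans_apply, schwartzTransport_follandHermite, schwartzTransport_reindexCLE_hermitePi,
      ← Finsupp.equivMapDomain_trans, Equiv.symm_symm, Equiv.self_trans_symm, Equiv.trans_assoc]
    congr 1
    ext k
    simp only [Finsupp.equivMapDomain_apply, Equiv.symm_trans_apply, Equiv.symm_symm, Equiv.symm_apply_apply, Equiv.coe_refl, id_eq,
      Equiv.refl_symm]

/-- **SPLIT**: every Hermite vector of the big frame is, in the junction frame at `σ`, a product `(e_* h_{β₁}) ⊠ h_{β₂}` with `|β| = |β₁| + |β₂|`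
(★ `schwartzTransport_follandHermite`, ★ `schwartzTransport_reindexCLE_hermitePi` three times, ★ `hermitePi_eq_tensorPi`, ★ `sumIdx_comapDomain`).
[cite: Folland1989, §1.7 (1.81)] [cite: Howe1989, §3] -/
theorem exists_degree_split_frame_follandHermite (β : (Fin (n' + n') × {v : InfinitePlace (Fp L) // v.IsReal}) →₀ ℕ) :
    ∃ (β₁ : DPIdx P Q R S →₀ ℕ) (β₂ : (Fin (n' + n') × {v : {v : InfinitePlace (Fp L) // v.IsReal} // v ≠ σ}) →₀ ℕ), β.degree = β₁.degree + β₂.degree ∧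
      ((((schwartzTransport
                  (scaledFrame (Fp L) (Fin (n' + n'))
                    (placeScale (n' + n') fun v => sqrtAbs (signVec (cmPlaceOver L)
                      (fun k => Sum.elim (cmGramEntry L e' dV hdV (tensorFrame L dW eW dV') (tensorFrame_real L dW hdW eW dV' hdV')) (-cmGramEntry L e' dV hdV (tensorFrame L dW eW dV') (tensorFrame_real L dW hdW eW dV' hdV')) ((LocalSplitting.e₂ n').symm k))
                      (imagUnit L) v))
                    (placeScale_ne_zero (n' + n') (sqrtAbs_signVec_ne_zero (IsCMField.complexConj_ne_one L) (cmPlaceOver_smul L)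
                      (complexConj_imagUnit L) (imagUnit_ne_zero L) (gramD_gram_realDiagonal_entry_ne_zero L e' dV hdV (tensorFrame L dW eW dV') (tensorFrame_real L dW hdW eW dV' hdV') hdV0 (tensorFrame_ne_zero L dW eW dV' hdW0 hdV'0)))))).trans
                (schwartzTransport (reindexCLE (placeSplitEquiv (signSplit (signVec (cmPlaceOver L)
                  (fun k => Sum.elim (cmGramEntry L e' dV hdV (tensorFrame L dW eW dV') (tensorFrame_real L dW hdW eW dV' hdV')) (-cmGramEntry L e' dV hdV (tensorFrame L dW eW dV') (tensorFrame_real L dW hdW eW dV' hdV')) ((LocalSplitting.e₂ n').symm k))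
                  (imagUnit L) σ)) σ)))).trans
                (schwartzTransport (reindexCLE (Equiv.sumCongr
                  (unitJunctionIdx
                    (PosIdx (signVec (cmPlaceOver L)
                      (fun k => Sum.elim (cmGramEntry L e' dV hdV (tensorFrame L dW eW dV') (tensorFrame_real L dW hdW eW dV' hdV')) (-cmGramEntry L e' dV hdV (tensorFrame L dW eW dV') (tensorFrame_real L dW hdW eW dV' hdV')) ((LocalSplitting.e₂ n').symm k))
                      (imagUnit L) σ))
                    (NegIdx (signVec (cmPlaceOver L)
                      (fun k => Sum.elim (cmGramEntry L e' dV hdV (tensorFrame L dW eW dV') (tensorFrame_real L dW hdW eW dV' hdV')) (-cmGramEntry L e' dV hdV (tensorFrame L dW eW dV') (tensorFrame_real L dW hdW eW dV' hdV')) ((LocalSplitting.e₂ n').symm k))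
                      (imagUnit L) σ))).symm
                  (Equiv.refl (Fin (n' + n') × {v : {v : InfinitePlace (Fp L) // v.IsReal} // v ≠ σ})))))).trans
                (schwartzTransport (reindexCLE (Equiv.sumCongr
                  (dpIdxCongr
                    (PosIdx (signVec (cmPlaceOver L)
                      (fun k => Sum.elim (cmGramEntry L e' dV hdV (tensorFrame L dW eW dV') (tensorFrame_real L dW hdW eW dV' hdV')) (-cmGramEntry L e' dV hdV (tensorFrame L dW eW dV') (tensorFrame_real L dW hdW eW dV' hdV')) ((LocalSplitting.e₂ n').symm k))
                      (imagUnit L) σ))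
                    (NegIdx (signVec (cmPlaceOver L)
                      (fun k => Sum.elim (cmGramEntry L e' dV hdV (tensorFrame L dW eW dV') (tensorFrame_real L dW hdW eW dV' hdV')) (-cmGramEntry L e' dV hdV (tensorFrame L dW eW dV') (tensorFrame_real L dW hdW eW dV' hdV')) ((LocalSplitting.e₂ n').symm k))
                      (imagUnit L) σ))
                    Unit Empty ((P × R) ⊕ (Q × S)) ((P × S) ⊕ (Q × R)) Unit Empty eP eQ (Equiv.refl Unit) (Equiv.refl Empty)).symm
                  (Equiv.refl (Fin (n' + n') × {v : {v : InfinitePlace (Fp L) // v.IsReal} // v ≠ σ})))))) (follandHermite (GRConstruction.frameD L e' dV hdV hdV0 (tensorFrame L dW eW dV') (tensorFrame_real L dW hdW eW dV' hdV') (tensorFrame_ne_zero L dW eW dV' hdW0 hdV'0)) β) =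
        tensorPi ((schwartzTransport (reindexCLE (unitJunctionIdx ((P × R) ⊕ (Q × S)) ((P × S) ⊕ (Q × R))).symm)) (hermitePi β₁)) (hermitePi β₂) := by
  -- `𝒥 (follandHermite frameD β) = h_{β′}`, `β′ = β` pushed through the three relabellings
  have hJ : ((((schwartzTransport
                  (scaledFrame (Fp L) (Fin (n' + n'))
                    (placeScale (n' + n') fun v => sqrtAbs (signVec (cmPlaceOver L)
                      (fun k => Sum.elim (cmGramEntry L e' dV hdV (tensorFrame L dW eW dV') (tensorFrame_real L dW hdW eW dV' hdV')) (-cmGramEntry L e' dV hdV (tensorFrame L dW eW dV') (tensorFrame_real L dW hdW eW dV' hdV')) ((LocalSplitting.e₂ n').symm k))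
                      (imagUnit L) v))
                    (placeScale_ne_zero (n' + n') (sqrtAbs_signVec_ne_zero (IsCMField.complexConj_ne_one L) (cmPlaceOver_smul L)
                      (complexConj_imagUnit L) (imagUnit_ne_zero L) (gramD_gram_realDiagonal_entry_ne_zero L e' dV hdV (tensorFrame L dW eW dV') (tensorFrame_real L dW hdW eW dV' hdV') hdV0 (tensorFrame_ne_zero L dW eW dV' hdW0 hdV'0)))))).trans
                (schwartzTransport (reindexCLE (placeSplitEquiv (signSplit (signVec (cmPlaceOver L)
                  (fun k => Sum.elim (cmGramEntry L e' dV hdV (tensorFrame L dW eW dV') (tensorFrame_real L dW hdW eW dV' hdV')) (-cmGramEntry L e' dV hdV (tensorFrame L dW eW dV') (tensorFrame_real L dW hdW eW dV' hdV')) ((LocalSplitting.e₂ n').symm k))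
                  (imagUnit L) σ)) σ)))).trans
                (schwartzTransport (reindexCLE (Equiv.sumCongr
                  (unitJunctionIdx
                    (PosIdx (signVec (cmPlaceOver L)
                      (fun k => Sum.elim (cmGramEntry L e' dV hdV (tensorFrame L dW eW dV') (tensorFrame_real L dW hdW eW dV' hdV')) (-cmGramEntry L e' dV hdV (tensorFrame L dW eW dV') (tensorFrame_real L dW hdW eW dV' hdV')) ((LocalSplitting.e₂ n').symm k))
                      (imagUnit L) σ))
                    (NegIdx (signVec (cmPlaceOver L)
                      (fun k => Sum.elim (cmGramEntry L e' dV hdV (tensorFrame L dW eW dV') (tensorFrame_real L dW hdW eW dV' hdV')) (-cmGramEntry L e' dV hdV (tensorFrame L dW eW dV') (tensorFrame_real L dW hdW eW dV' hdV')) ((LocalSplitting.e₂ n').symm k))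
                      (imagUnit L) σ))).symm
                  (Equiv.refl (Fin (n' + n') × {v : {v : InfinitePlace (Fp L) // v.IsReal} // v ≠ σ})))))).trans
                (schwartzTransport (reindexCLE (Equiv.sumCongr
                  (dpIdxCongr
                    (PosIdx (signVec (cmPlaceOver L)
                      (fun k => Sum.elim (cmGramEntry L e' dV hdV (tensorFrame L dW eW dV') (tensorFrame_real L dW hdW eW dV' hdV')) (-cmGramEntry L e' dV hdV (tensorFrame L dW eW dV') (tensorFrame_real L dW hdW eW dV' hdV')) ((LocalSplitting.e₂ n').symm k))
                      (imagUnit L) σ))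
                    (NegIdx (signVec (cmPlaceOver L)
                      (fun k => Sum.elim (cmGramEntry L e' dV hdV (tensorFrame L dW eW dV') (tensorFrame_real L dW hdW eW dV' hdV')) (-cmGramEntry L e' dV hdV (tensorFrame L dW eW dV') (tensorFrame_real L dW hdW eW dV' hdV')) ((LocalSplitting.e₂ n').symm k))
                      (imagUnit L) σ))
                    Unit Empty ((P × R) ⊕ (Q × S)) ((P × S) ⊕ (Q × R)) Unit Empty eP eQ (Equiv.refl Unit) (Equiv.refl Empty)).symm
                  (Equiv.refl (Fin (n' + n') × {v : {v : InfinitePlace (Fp L) // v.IsReal} // v ≠ σ})))))) (follandHermite (GRConstruction.frameD L e' dV hdV hdV0 (tensorFrame L dW eW dV') (tensorFrame_real L dW hdW eW dV' hdV') (tensorFrame_ne_zero L dW eW dV' hdW0 hdV'0)) β) =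
      hermitePi (((β.equivMapDomain (placeSplitEquiv (signSplit (signVec (cmPlaceOver L) (fun k => Sum.elim (cmGramEntry L e' dV hdV (tensorFrame L dW eW dV') (tensorFrame_real L dW hdW eW dV' hdV')) (-cmGramEntry L e' dV hdV (tensorFrame L dW eW dV') (tensorFrame_real L dW hdW eW dV' hdV')) ((LocalSplitting.e₂ n').symm k)) (imagUnit L) σ)) σ).symm).equivMapDomain (Equiv.sumCongr (unitJunctionIdx (PosIdx (signVec (cmPlaceOver L) (fun k => Sum.elim (cmGramEntry L e' dV hdV (tensorFrame L dW eW dV') (tensorFrame_real L dW hdW eW dV' hdV')) (-cmGramEntry L e' dV hdV (tensorFrame L dW eW dV') (tensorFrame_real L dW hdW eW dV' hdV')) ((LocalSplitting.e₂ n').symm k)) (imagUnit L) σ)) (NegIdx (signVec (cmPlaceOver L) (fun k => Sum.elim (cmGramEntry L e' dV hdV (tensorFrame L dW eW dV') (tensorFrame_real L dW hdW eW dV' hdV')) (-cmGramEntry L e' dV hdV (tensorFrame L dW eW dV') (tensorFrame_real L dW hdW eW dV' hdV')) ((LocalSplitting.e₂ n').symm k)) (imagUnit L) σ))).symm (Equiv.refl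 (Fin (n' + n') × {v : {v : InfinitePlace (Fp L) // v.IsReal} // v ≠ σ}))).symm).equivMapDomain (Equiv.sumCongr
        (dpIdxCongr (PosIdx (signVec (cmPlaceOver L) (fun k => Sum.elim (cmGramEntry L e' dV hdV (tensorFrame L dW eW dV') (tensorFrame_real L dW hdW eW dV' hdV')) (-cmGramEntry L e' dV hdV (tensorFrame L dW eW dV') (tensorFrame_real L dW hdW eW dV' hdV')) ((LocalSplitting.e₂ n').symm k)) (imagUnit L) σ)) (NegIdx (signVec (cmPlaceOver L) (fun k => Sum.elim (cmGramEntry L e' dV hdV (tensorFrame L dW eW dV') (tensorFrame_real L dW hdW eW dV' hdV')) (-cmGramEntry L e' dV hdV (tensorFrame L dW eW dV') (tensorFrame_real L dW hdW eW dV' hdV')) ((LocalSplitting.e₂ n').symm k)) (imagUnit L) σ)) Unit Empty ((P × R) ⊕ (Q × S)) ((P × S) ⊕ (Q × R)) Unit Empty eP eQ (Equiv.refl Unit)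
          (Equiv.refl Empty)).symm
        (Equiv.refl (Fin (n' + n') × {v : {v : InfinitePlace (Fp L) // v.IsReal} // v ≠ σ}))).symm) := by
    simp only [ContinuousLinearEquiv.trans_apply, schwartzTransport_follandHermite, schwartzTransport_reindexCLE_hermitePi]
  refine ⟨((((β.equivMapDomain (placeSplitEquiv (signSplit (signVec (cmPlaceOver L) (fun k => Sum.elim (cmGramEntry L e' dV hdV (tensorFrame L dW eW dV') (tensorFrame_real L dW hdW eW dV' hdV')) (-cmGramEntry L e' dV hdV (tensorFrame L dW eW dV') (tensorFrame_real L dW hdW eW dV' hdV')) ((LocalSplitting.e₂ n').symm k)) (imagUnit L) σ)) σ).symm).equivMapDomain (Equiv.sumCongr (unitJunctionIdx (PosIdx (signVec (cmPlaceOver L) (fun k => Sum.elim (cmGramEntry L e' dV hdV (tensorFrame L dW eW dV') (tensorFrame_real L dW hdW eW dV' hdV')) (-cmGramEntry L e' dV hdV (tensorFrame L dW eW dV') (tensorFrame_real L dW hdW eW dV' hdV')) ((LocalSplitting.e₂ n').symm k)) (imagUnit L) σ)) (NegIdx (signVec (cmPlaceOver L) (fun k => Sum.elim (cmGramEntry L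 e' dV hdV (tensorFrame L dW eW dV') (tensorFrame_real L dW hdW eW dV' hdV')) (-cmGramEntry L e' dV hdV (tensorFrame L dW eW dV') (tensorFrame_real L dW hdW eW dV' hdV')) ((LocalSplitting.e₂ n').symm k)) (imagUnit L) σ))).symm (Equiv.refl (Fin (n' + n') × {v : {v : InfinitePlace (Fp L) // v.IsReal} // v ≠ σ}))).symm).equivMapDomain (Equiv.sumCongr
        (dpIdxCongr (PosIdx (signVec (cmPlaceOver L) (fun k => Sum.elim (cmGramEntry L e' dV hdV (tensorFrame L dW eW dV') (tensorFrame_real L dW hdW eW dV' hdV')) (-cmGramEntry L e' dV hdV (tensorFrame L dW eW dV') (tensorFrame_real L dW hdW eW dV' hdV')) ((LocalSplitting.e₂ n').symm k)) (imagUnit L) σ)) (NegIdx (signVec (cmPlaceOver L) (fun k => Sum.elim (cmGramEntry L e' dV hdV (tensorFrame L dW eW dV') (tensorFrame_real L dW hdW eW dV' hdV')) (-cmGramEntry L e' dV hdV (tensorFrame L dW eW dV') (tensorFrame_real L dW hdW eW dV' hdV')) ((LocalSplitting.e₂ n').symm k)) (imagUnit L) σ)) Unit Empty ((P × R) ⊕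 (Q × S)) ((P × S) ⊕ (Q × R)) Unit Empty eP eQ (Equiv.refl Unit)
          (Equiv.refl Empty)).symm
        (Equiv.refl (Fin (n' + n') × {v : {v : InfinitePlace (Fp L) // v.IsReal} // v ≠ σ}))).symm).comapDomain Sum.inl
      Sum.inl_injective.injOn).equivMapDomain (unitJunctionIdx ((P × R) ⊕ (Q × S)) ((P × S) ⊕ (Q × R))).symm,
    (((β.equivMapDomain (placeSplitEquiv (signSplit (signVec (cmPlaceOver L) (fun k => Sum.elim (cmGramEntry L e' dV hdV (tensorFrame L dW eW dV') (tensorFrame_real L dW hdW eW dV' hdV')) (-cmGramEntry L e' dV hdV (tensorFrame L dW eW dV') (tensorFrame_real L dW hdW eW dV' hdV')) ((LocalSplitting.e₂ n').symm k)) (imagUnit L) σ)) σ).symm).equivMapDomain (Equiv.sumCongr (unitJunctionIdx (PosIdx (signVec (cmPlaceOver L) (fun k => Sum.elim (cmGramEntry L e' dV hdV (tensorFrame L dW eW dV') (tensorFrame_real L dW hdW eW dV' hdV')) (-cmGramEntry L e' dV hdV (tensorFrame L dW eW dV') (tensorFrame_real L dW hdW eW dV' hdV')) ((LocalSplitting.e₂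 n').symm k)) (imagUnit L) σ)) (NegIdx (signVec (cmPlaceOver L) (fun k => Sum.elim (cmGramEntry L e' dV hdV (tensorFrame L dW eW dV') (tensorFrame_real L dW hdW eW dV' hdV')) (-cmGramEntry L e' dV hdV (tensorFrame L dW eW dV') (tensorFrame_real L dW hdW eW dV' hdV')) ((LocalSplitting.e₂ n').symm k)) (imagUnit L) σ))).symm (Equiv.refl (Fin (n' + n') × {v : {v : InfinitePlace (Fp L) // v.IsReal} // v ≠ σ}))).symm).equivMapDomain (Equiv.sumCongr
        (dpIdxCongr (PosIdx (signVec (cmPlaceOver L) (fun k => Sum.elim (cmGramEntry L e' dV hdV (tensorFrame L dW eW dV') (tensorFrame_real L dW hdW eW dV' hdV')) (-cmGramEntry L e' dV hdV (tensorFrame L dW eW dV') (tensorFrame_real L dW hdW eW dV' hdV')) ((LocalSplitting.e₂ n').symm k)) (imagUnit L) σ)) (NegIdx (signVec (cmPlaceOver L) (fun k => Sum.elim (cmGramEntry L e' dV hdV (tensorFrame L dW eW dV') (tensorFrame_real L dW hdW eW dV' hdV')) (-cmGramEntry L e' dV hdV (tensorFrame L dW eW dV') (tensorFrame_real L dW hdW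 eW dV' hdV')) ((LocalSplitting.e₂ n').symm k)) (imagUnit L) σ)) Unit Empty ((P × R) ⊕ (Q × S)) ((P × S) ⊕ (Q × R)) Unit Empty eP eQ (Equiv.refl Unit)
          (Equiv.refl Empty)).symm
        (Equiv.refl (Fin (n' + n') × {v : {v : InfinitePlace (Fp L) // v.IsReal} // v ≠ σ}))).symm).comapDomain Sum.inr Sum.inr_injective.injOn, ?_, ?_⟩
  · rw [degree_equivMapDomain, ← degree_eq_degree_comapDomain_add, degree_equivMapDomain, degree_equivMapDomain, degree_equivMapDomain]
  · -- `e_* h_{γ ∘ unitJ} = h_γ`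
    have hR : ∀ γ : DPIdx ((P × R) ⊕ (Q × S)) ((P × S) ⊕ (Q × R)) Unit Empty →₀ ℕ,
        (schwartzTransport (reindexCLE (unitJunctionIdx ((P × R) ⊕ (Q × S)) ((P × S) ⊕ (Q × R))).symm)) (hermitePi (γ.equivMapDomain (unitJunctionIdx ((P × R) ⊕ (Q × S)) ((P × S) ⊕ (Q × R))).symm)) = hermitePi γ := fun γ => by
      rw [schwartzTransport_reindexCLE_hermitePi, ← Finsupp.equivMapDomain_trans, Equiv.self_trans_symm, Finsupp.equivMapDomain_refl]
    rw [hJ, hR, ← hermitePi_eq_tensorPi]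
    -- the two sides now differ only in the (subsingleton) `Fintype` instance of the index type
    congr 1

end Frame

end Summit.HodgeConjecture.HodgeConjecture.Cruxes.HLiu418.K2LiuArchHermiteGlue

end
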